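import Summits.CriticalPhenomena.PercolationContinuityZ3.Theorems.Transplant.SiteSetExplorationWorld
import HarnessLib

/-!
# SITE percolation: the site exploration as a decision tree and Gladkov's Harris–Kleitman inequality along it
# (WP3 step 1 of P1-SITE-Z3 §16, part 3; site twin of `L/SetClusterExploration.lean` §§Tree/HK)

builds on p205010 (kernel theorem, internal audit signed; external expert review pending).

`ttree`, `revealedAt_eq_revealed`, **`PrW_mul_PrW_le_Pr2W_hybrid`** (Gladkov Thm 3.2 along the site exploration of the cluster of a source set;
coordinates = vertices, the generic layer `L/DecisionTreeWeighted` / `L/DecisionTreeBK` used with `ι = V`), `Pr2W_hybrid_mem`,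
`sum_pair_reindex_hybrid`, `sum_wtW_mul_condSumW`, `condSumW_splice`, `sum_wtW_ind_mul_condSumW`, **`PrW_mul_PrW_le_sum_condSumW_mul`**.
Definitions + proofs (`--supports stmt-CriticalPhenomena-4575 --as helper`); no named facts, no sorries.
[cite: Gladkov2024, Def. 2.4, Lemma 3.1, Thm. 3.2 (p. 4)]
-/

noncomputable section

open Classical

namespace Summit.CriticalPhenomena.PercolationContinuityZ3.Theorems.Transplant

namespace SiteSetExploration

open Finset
open Literature.Probability.Percolation
open Literature.Probability.Percolation.DecisionTree
open SiteBHK (sC)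

variable {V : Type*} [Fintype V] [DecidableEq V] {Γ : SimpleGraph V}

/-! ### The decision tree and the Harris–Kleitman inequality along it -/

section Tree

variable (D : Finset V) (N : Finset V)

/-- The site exploration as a decision tree (coordinates = vertices). [cite: Gladkov2024, Def. 2.4 and Example 2.5] -/
def ttree : ℕ → SSt V → DTree V
  | 0, _ => .leaf
  | n + 1, σ =>
      match pickV (bnd Γ D N σ) with
      | none => .leaf
      | some u => .node u (ttree n ⟨insert u σ.vis, insert u σ.rev⟩) (ttree n ⟨σ.vis, insert u σ.rev⟩)

variable {D N}

omit [Fintype V] in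
/-- **The tree reveals what the exploration reveals.** [cite: Gladkov2024, Def. 2.4 and Example 2.5] -/
theorem rev_iterate_step (K : Finset V) :
    ∀ (n : ℕ) (σ : SSt V), ((step Γ D N K)^[n] σ).rev = σ.rev ∪ revealed (ttree (Γ := Γ) D N n σ) K
  | 0, σ => by simp [ttree, revealed]
  | n + 1, σ => by
      rw [Function.iterate_succ_apply]
      by_cases h : bnd Γ D N σ = ∅
      · rw [step_of_bnd_eq_empty h, Function.iterate_fixed (step_of_bnd_eq_empty h)]
        simp [ttree, pickV_eq_none_iff.2 h, revealed]
      · obtain ⟨u, -, hpick, hstep⟩ := step_of_bnd_ne_empty (Γ := Γ) (D := D) (N := N) (K := K) h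
        have htree : ttree (Γ := Γ) D N (n + 1) σ =
            .node u (ttree (Γ := Γ) D N n ⟨insert u σ.vis, insert u σ.rev⟩) (ttree (Γ := Γ) D N n ⟨σ.vis, insert u σ.rev⟩) := by
          simp only [ttree, hpick]
        rw [hstep, htree]
        by_cases hu : u ∈ K
        · rw [if_pos hu, rev_iterate_step K n]
          simp only [revealed, if_pos hu, Finset.insert_union, Finset.union_insert]
        · rw [if_neg hu, rev_iterate_step K n]
          simp only [revealed, if_neg hu, Finset.insert_union, Finset.union_insert]

omit [Fintype V] in
/-- `run` is the iterated `step`. [folklore] -/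
private theorem run_eq_iterate (K : Finset V) : ∀ k : ℕ, run Γ D N K k = (step Γ D N K)^[k] init
  | 0 => rfl
  | k + 1 => by rw [run_succ, Function.iterate_succ_apply', run_eq_iterate K k]

omit [Fintype V] in
/-- **The revealed set of the full exploration is the set built by its decision tree.** [cite: Gladkov2024, Def. 2.4] -/
theorem revealedAt_eq_revealed (K : Finset V) :
    revealedAt Γ D N K = revealed (ttree (Γ := Γ) D N (D.card + 1) init) K := by
  rw [revealedAt, fin, run_eq_iterate, rev_iterate_step]
  simp [init]

end Tree

section HK

variable (D : Finset V) (N : Finset V) {p : V → ℝ}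

omit [Fintype V] in
/-- **Decision-tree Harris–Kleitman along the site exploration of the cluster of a set** (Gladkov 2024, Thm 3.2, for this tree):
`P(X)·P(Y) ≤ P⊗P{(K₁, K₂) : K₁ ∈ X, K₁ →_{S_N(K₁)} K₂ ∈ Y}` for up-closed `X, Y`. [cite: Gladkov2024, Thm. 3.2 (p. 4)] -/
theorem PrW_mul_PrW_le_Pr2W_hybrid (hp0 : ∀ v, 0 ≤ p v) (hp1 : ∀ v, p v ≤ 1)
    {X Y : Set (Finset V)} (hX : IsUpperSet X) (hY : IsUpperSet Y) :
    PrW D p X * PrW D p Y ≤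
      Pr2W D p {c | c.1 ∈ X ∧ splice (revealedAt Γ D N c.1) c.1 c.2 ∈ Y} := by
  have h := PrW_mul_PrW_le_Pr2W_treeHK D hp0 hp1 (ttree (Γ := Γ) D N (D.card + 1) init) hX hY
  have hset : treeHK ∅ (ttree (Γ := Γ) D N (D.card + 1) init) X Y =
      {c | c.1 ∈ X ∧ splice (revealedAt Γ D N c.1) c.1 c.2 ∈ Y} := by
    ext c
    simp only [treeHK, hkWith, Finset.empty_union, Set.mem_setOf_eq, revealedAt_eq_revealed]
  rwa [hset] at h

omit [Fintype V] in
/-- **The hybrid is again a configuration**: its law under `P ⊗ P` is `P`. [cite: Gladkov2024, Lemma 3.1] -/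
theorem Pr2W_hybrid_mem (p : V → ℝ) (Y : Set (Finset V)) :
    Pr2W D p {c | splice (revealedAt Γ D N c.1) c.1 c.2 ∈ Y} = PrW D p Y := by
  have h := Pr2W_preimage_swapPair D p (selfDetermined_revealedAt (Γ := Γ) (D := D) (N := N)) (Y ×ˢ Set.univ)
  have hset : swapPair (revealedAt Γ D N) ⁻¹' (Y ×ˢ Set.univ) = {c | splice (revealedAt Γ D N c.1) c.1 c.2 ∈ Y} := by
    ext c
    simp [swapPair]
  rw [hset] at h
  rw [h, Pr2W_prod, PrW_univ, mul_one]

omit [Fintype V] in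
/-- **Reindexing by the hybrid.** [cite: Gladkov2024, Lemma 3.1] -/
theorem sum_pair_reindex_hybrid (p : V → ℝ) (f : Finset V × Finset V → ℝ) :
    ∑ x ∈ D.powerset ×ˢ D.powerset, wt2W D p x * f x =
      ∑ x ∈ D.powerset ×ˢ D.powerset, wt2W D p x * f (swapPair (revealedAt Γ D N) x) :=
  sum_pair_reindexW D p (selfDetermined_revealedAt (Γ := Γ) (D := D) (N := N)) f

omit [Fintype V] in
/-- **Law of the hybrid, conditional form** (tower property). [cite: Gladkov2024, Lemma 3.1] -/
theorem sum_wtW_mul_condSumW (p : V → ℝ) (B : Set (Finset V)) :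
    ∑ K ∈ D.powerset, wtW D p K * condSumW D p (revealedAt Γ D N) B K = PrW D p B := by
  rw [← Pr2W_hybrid_mem (Γ := Γ) D N p B, Pr2W_eq_sum_ind, Finset.sum_product]
  refine Finset.sum_congr rfl fun K _ => ?_
  unfold condSumW
  rw [Finset.mul_sum]
  refine Finset.sum_congr rfl fun K₂ _ => ?_
  have : ind {c : Finset V × Finset V | splice (revealedAt Γ D N c.1) c.1 c.2 ∈ B} (K, K₂) =
      ind B (splice (revealedAt Γ D N K) K K₂) := by
    by_cases h : splice (revealedAt Γ D N K) K K₂ ∈ B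
    · rw [ind_of_mem h, ind_of_mem (show (K, K₂) ∈ {c : Finset V × Finset V |
        splice (revealedAt Γ D N c.1) c.1 c.2 ∈ B} from h)]
    · rw [ind_of_not_mem h, ind_of_not_mem (show (K, K₂) ∉ {c : Finset V × Finset V |
        splice (revealedAt Γ D N c.1) c.1 c.2 ∈ B} from h)]
  rw [this, wt2W]
  ring

omit [Fintype V] in
/-- The conditional probability given the exploration data is the same for the hybrid as for `K₁`. [cite: Gladkov2024, Lemma 3.1] -/
theorem condSumW_splice (p : V → ℝ) (B : Set (Finset V)) (K K₂ : Finset V) :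
    condSumW D p (revealedAt Γ D N) B (splice (revealedAt Γ D N K) K K₂) = condSumW D p (revealedAt Γ D N) B K :=
  condSumW_congr D p (selfDetermined_revealedAt (Γ := Γ) (D := D) (N := N)) B
    fun u hu => (splice_agree _ K K₂ u hu).symm

omit [Fintype V] in
/-- **Tower identity** `E[1_X · E[1_Y | 𝓕_N]] = E[E[1_X | 𝓕_N] · E[1_Y | 𝓕_N]]` along the site exploration. [cite: Gladkov2024, Lemma 3.1] -/
theorem sum_wtW_ind_mul_condSumW (p : V → ℝ) (X Y : Set (Finset V)) :
    ∑ K ∈ D.powerset, wtW D p K * ind X K * condSumW D p (revealedAt Γ D N) Y K =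
      ∑ K ∈ D.powerset, wtW D p K * condSumW D p (revealedAt Γ D N) X K *
        condSumW D p (revealedAt Γ D N) Y K := by
  have hL : ∑ K ∈ D.powerset, wtW D p K * ind X K * condSumW D p (revealedAt Γ D N) Y K =
      ∑ x ∈ D.powerset ×ˢ D.powerset, wt2W D p x * (ind X x.1 * condSumW D p (revealedAt Γ D N) Y x.1) := by
    rw [Finset.sum_product]
    refine Finset.sum_congr rfl fun K _ => ?_
    have : ∑ K₂ ∈ D.powerset, wt2W D p (K, K₂) * (ind X K * condSumW D p (revealedAt Γ D N) Y K) =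
        wtW D p K * ind X K * condSumW D p (revealedAt Γ D N) Y K * ∑ K₂ ∈ D.powerset, wtW D p K₂ := by
      rw [Finset.mul_sum]
      refine Finset.sum_congr rfl fun K₂ _ => ?_
      rw [wt2W]; ring
    rw [this, sum_wtW, mul_one]
  have hR : ∑ K ∈ D.powerset, wtW D p K * condSumW D p (revealedAt Γ D N) X K *
        condSumW D p (revealedAt Γ D N) Y K =
      ∑ x ∈ D.powerset ×ˢ D.powerset, wt2W D p x *
        (ind X (splice (revealedAt Γ D N x.1) x.1 x.2) * condSumW D p (revealedAt Γ D N) Y x.1) := by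
    rw [Finset.sum_product]
    refine Finset.sum_congr rfl fun K _ => ?_
    have : ∑ K₂ ∈ D.powerset, wt2W D p (K, K₂) *
          (ind X (splice (revealedAt Γ D N K) K K₂) * condSumW D p (revealedAt Γ D N) Y K) =
        wtW D p K * condSumW D p (revealedAt Γ D N) Y K *
          ∑ K₂ ∈ D.powerset, wtW D p K₂ * ind X (splice (revealedAt Γ D N K) K K₂) := by
      rw [Finset.mul_sum]
      refine Finset.sum_congr rfl fun K₂ _ => ?_
      rw [wt2W]; ring
    rw [this]
    unfold condSumW
    ring
  rw [hL, hR, sum_pair_reindex_hybrid (Γ := Γ) D N p]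
  refine Finset.sum_congr rfl fun x _ => ?_
  simp only [swapPair]
  rw [condSumW_splice]

omit [Fintype V] in
/-- **Decision-tree Harris–Kleitman, conditional-expectation form** along the site exploration: for up-closed `X, Y`,
`P(X) P(Y) ≤ Σ_K w(K) · P(X | 𝓕_N)(K) · P(Y | 𝓕_N)(K)`. [cite: Gladkov2024, Thm. 3.2 (p. 4)] -/
theorem PrW_mul_PrW_le_sum_condSumW_mul (hp0 : ∀ v, 0 ≤ p v) (hp1 : ∀ v, p v ≤ 1)
    {X Y : Set (Finset V)} (hX : IsUpperSet X) (hY : IsUpperSet Y) :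
    PrW D p X * PrW D p Y ≤
      ∑ K ∈ D.powerset, wtW D p K * condSumW D p (revealedAt Γ D N) X K *
        condSumW D p (revealedAt Γ D N) Y K := by
  have h := PrW_mul_PrW_le_Pr2W_hybrid (Γ := Γ) D N hp0 hp1 hX hY
  rw [← sum_wtW_ind_mul_condSumW]
  refine h.trans (le_of_eq ?_)
  rw [Pr2W_eq_sum_ind, Finset.sum_product]
  refine Finset.sum_congr rfl fun K _ => ?_
  unfold condSumW
  rw [Finset.mul_sum]
  refine Finset.sum_congr rfl fun K₂ _ => ?_
  have : ind {c : Finset V × Finset V | c.1 ∈ X ∧ splice (revealedAt Γ D N c.1) c.1 c.2 ∈ Y}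
      (K, K₂) = ind X K * ind Y (splice (revealedAt Γ D N K) K K₂) := by
    by_cases h1 : K ∈ X
    · by_cases h2 : splice (revealedAt Γ D N K) K K₂ ∈ Y
      · rw [ind_of_mem h1, ind_of_mem h2, ind_of_mem (show (K, K₂) ∈ {c : Finset V × Finset V |
          c.1 ∈ X ∧ splice (revealedAt Γ D N c.1) c.1 c.2 ∈ Y} from ⟨h1, h2⟩)]
        ring
      · rw [ind_of_not_mem h2, ind_of_not_mem (show (K, K₂) ∉ {c : Finset V × Finset V |
          c.1 ∈ X ∧ splice (revealedAt Γ D N c.1) c.1 c.2 ∈ Y} from fun h => h2 h.2)]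
        ring
    · rw [ind_of_not_mem h1, ind_of_not_mem (show (K, K₂) ∉ {c : Finset V × Finset V |
        c.1 ∈ X ∧ splice (revealedAt Γ D N c.1) c.1 c.2 ∈ Y} from fun h => h1 h.1)]
      ring
  rw [this, wt2W]
  ring

end HK

end SiteSetExploration

end Summit.CriticalPhenomena.PercolationContinuityZ3.Theorems.Transplant
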